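import Literature.Topology.FourManifolds.GompfFramedSpheres
import HarnessLib

/-!
# Reparametrising the tube of a circle surgery by a compactly supported diffeomorphism

Generic four-manifold infrastructure for the well-definedness of surgery on a framed circle
(Gompf–Stipsicz, *4-Manifolds and Kirby Calculus*, §5.2: the result of surgery depends only on the
isotopy class of the framed embedding; Kosinski, *Differential Manifolds*, VI.1–2). We prove the
special case that is a *formula*: precomposing the tubular neighbourhood `ν : 𝕊¹ × ℝ³ ↪ X` of a
circle `c` with a diffeomorphism `G` of `𝕊¹ × ℝ³` that fixes the zero section and is the identity
outside `𝕊¹ × B̄(0, R)` does not change the surgered manifold: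

* `Literature.Topology.FourManifolds.TubeDiffeo` — such diffeomorphisms `G` (with their radius `R`), their inverses;
* `Literature.CircleNbhd.twist ν G` — the tube `ν ∘ G`, again a tubular neighbourhood of `c`;
* `Literature.CircleNbhd.twistDiffeo ν G : X ≃ₘ X` — the **ambient diffeomorphism** `ν ∘ G ∘ ν⁻¹` on the
  range of `ν`, extended by the identity (smooth because `G` is the identity near the frontier of
  the tube), with `twistDiffeo ν G ∘ ν = ν ∘ G` and fixing `c` pointwise;
* `Literature.Topology.FourManifolds.CircleNbhd.isOpenGluing_surgered_twist` — transporting the surgery gluing of `ν.Surgered`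
  along `twistDiffeo ν G` exhibits `ν.Surgered` as a surgery along `ν ∘ G`;
* `Literature.Topology.FourManifolds.CircleNbhd.nonempty_diffeomorph_surgered_twist` — **`ν.Surgered ≅ (ν ∘ G).Surgered`**, and
  `Literature.Topology.FourManifolds.CircleNbhd.nonempty_diffeomorph_surgered_of_eqOn_twist` — the same for any tube `ν'` of `c`
  that agrees with `ν ∘ G` on the unit ball bundle `𝕊¹ × B(0, 1)` (the surgery only uses that
  part of the tube), by uniqueness of open gluings (`IsOpenGluing.nonempty_diffeomorph`).

Written for the straightening-class invariance of Gompf's `X^σ_A`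
(`Literature.Topology.FourManifolds.gompf2010_straightening_invariance`, `GompfTheorem43.lean`): two framings of the section
circle of the Cappell–Shaneson mapping torus differ, on the unit ball bundle, by such a `G`.

## References

* R. Gompf, A. Stipsicz, *4-Manifolds and Kirby Calculus*, GSM 20 (1999), §5.2. [GompfStipsiczGSM1999]
* A. Kosinski, *Differential Manifolds* (1993), VI.1 (gluing; transport of gluings along
  diffeomorphisms of the pieces), III.3 (tubular neighbourhoods). [Kosinski1993]
-/

open scoped Manifold ContDiff Topology
open Set Function

noncomputable section

namespace Literature.Topology.FourManifolds

universe u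

/-- Local notation: `𝔼 n` is the model Euclidean space `EuclideanSpace ℝ (Fin n)`. -/
local notation "𝔼 " n:arg => EuclideanSpace ℝ (Fin n)

/-- Local notation: `𝕊 n` is the unit sphere in `EuclideanSpace ℝ (Fin (n + 1))`. -/
local notation "𝕊 " n:arg => (Metric.sphere (0 : EuclideanSpace ℝ (Fin (n + 1))) 1 : Set _)

/-! ### Compactly supported diffeomorphisms of `𝕊¹ × ℝ³` fixing the zero section -/

/-- **A compactly supported reparametrisation of the model tube**: a diffeomorphism `G` of
`𝕊¹ × ℝ³` which fixes the zero section `𝕊¹ × {0}` pointwise and is the identity on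
`𝕊¹ × {‖w‖ ≥ radius}` (Gompf–Stipsicz §5.2: changing the tubular neighbourhood within its
isotopy class; here the special changes that are formulas). [cite: GompfStipsiczGSM1999, §5.2] -/
structure TubeDiffeo where
  /-- The diffeomorphism of `𝕊¹ × ℝ³`. -/
  toDiffeomorph :
    ((𝕊 1) × 𝔼 3) ≃ₘ⟮(𝓡 1).prod 𝓘(ℝ, 𝔼 3), (𝓡 1).prod 𝓘(ℝ, 𝔼 3)⟯ ((𝕊 1) × 𝔼 3)
  /-- The radius outside which the diffeomorphism is the identity. -/
  radius : ℝ
  /-- The zero section is fixed pointwise. -/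
  apply_zero : ∀ u, toDiffeomorph (u, 0) = (u, 0)
  /-- Outside `𝕊¹ × B(0, radius)` the diffeomorphism is the identity. -/
  eq_self : ∀ p : (𝕊 1) × 𝔼 3, radius ≤ ‖p.2‖ → toDiffeomorph p = p

namespace TubeDiffeo

/-- The inverse reparametrisation (same radius). [folklore] -/
def symm (G : TubeDiffeo) : TubeDiffeo where
  toDiffeomorph := G.toDiffeomorph.symm
  radius := G.radius
  apply_zero u := G.toDiffeomorph.injective (by
    show G.toDiffeomorph (G.toDiffeomorph.symm (u, 0)) = G.toDiffeomorph (u, 0)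
    rw [Diffeomorph.apply_symm_apply, G.apply_zero])
  eq_self p hp := G.toDiffeomorph.injective (by
    show G.toDiffeomorph (G.toDiffeomorph.symm p) = G.toDiffeomorph p
    rw [Diffeomorph.apply_symm_apply, G.eq_self p hp])

/-- `G.symm` undoes `G`. [folklore] -/
@[simp] theorem symm_apply_apply (G : TubeDiffeo) (p : (𝕊 1) × 𝔼 3) :
    G.symm.toDiffeomorph (G.toDiffeomorph p) = p :=
  G.toDiffeomorph.symm_apply_apply p

/-- `G` undoes `G.symm`. [folklore] -/
@[simp] theorem apply_symm_apply (G : TubeDiffeo) (p : (𝕊 1) × 𝔼 3) :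
    G.toDiffeomorph (G.symm.toDiffeomorph p) = p :=
  G.toDiffeomorph.apply_symm_apply p

/-- `G.symm.symm = G`. [folklore] -/
@[simp] theorem symm_symm (G : TubeDiffeo) : G.symm.symm = G := rfl

/-- A point moved by `G` lies in `𝕊¹ × B(0, radius)`. [folklore] -/
theorem norm_lt_of_ne (G : TubeDiffeo) {p : (𝕊 1) × 𝔼 3} (hp : G.toDiffeomorph p ≠ p) :
    ‖p.2‖ < G.radius :=
  not_le.1 fun h ↦ hp (G.eq_self p h)

end TubeDiffeo

/-! ### The reparametrised tube and the ambient diffeomorphism -/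

namespace CircleNbhd

variable {X : Type u} [TopologicalSpace X] [ChartedSpace (𝔼 4) X] {c : 𝕊 1 → X}
  (ν : CircleNbhd (𝓡 4) c) (G : TubeDiffeo)

/-- **The reparametrised tube `ν ∘ G`**, again a tubular neighbourhood of the same circle `c`
(`G` fixes the zero section). [cite: GompfStipsiczGSM1999, §5.2] -/
def twist : CircleNbhd (𝓡 4) c where
  toFun := ν.toFun ∘ G.toDiffeomorph
  isSmoothEmbedding := ν.isSmoothEmbedding.comp_diffeomorph G.toDiffeomorph
  isOpen_range := by
    have hs : Surjective (fun p ↦ G.toDiffeomorph p) := G.toDiffeomorph.surjective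
    rw [Set.range_comp, hs.range_eq, image_univ]
    exact ν.isOpen_range
  apply_zero u := by
    simp only [Function.comp_apply, G.apply_zero, ν.apply_zero]

/-- The reparametrised tube, pointwise. [folklore] -/
@[simp] theorem twist_apply (p : (𝕊 1) × 𝔼 3) : (ν.twist G).toFun p = ν.toFun (G.toDiffeomorph p) :=
  rfl

open scoped Classical in
/-- The map `ν ∘ G ∘ ν⁻¹` on the range of `ν`, extended by the identity. [folklore] -/
def twistFun (x : X) : X :=
  if x ∈ range ν.toFun then ν.toFun (G.toDiffeomorph (ν.toHomeo.symm x)) else x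

/-- On the tube, `twistFun` is `ν ∘ G ∘ ν⁻¹`. [folklore] -/
theorem twistFun_apply_toFun (p : (𝕊 1) × 𝔼 3) :
    ν.twistFun G (ν.toFun p) = ν.toFun (G.toDiffeomorph p) := by
  rw [twistFun, if_pos (mem_range_self p), toHomeo_symm_apply]

/-- Off the tube, `twistFun` is the identity. [folklore] -/
theorem twistFun_of_not_mem {x : X} (hx : x ∉ range ν.toFun) : ν.twistFun G x = x := by
  rw [twistFun, if_neg hx]

/-- `twistFun` is the identity off the image of `𝕊¹ × B(0, radius)`. [folklore] -/
theorem twistFun_eq_self {x : X} (hx : x ∉ ν.toFun '' {p | ‖p.2‖ < G.radius}) :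
    ν.twistFun G x = x := by
  by_cases h : x ∈ range ν.toFun
  · obtain ⟨p, rfl⟩ := h
    rw [twistFun_apply_toFun]
    congr 1
    by_contra hne
    exact hx ⟨p, G.norm_lt_of_ne hne, rfl⟩
  · exact ν.twistFun_of_not_mem G h

/-- `twistFun` for `G.symm` undoes `twistFun` for `G`. [folklore] -/
theorem twistFun_symm_twistFun (x : X) : ν.twistFun G.symm (ν.twistFun G x) = x := by
  by_cases h : x ∈ range ν.toFun
  · obtain ⟨p, rfl⟩ := h
    rw [twistFun_apply_toFun, twistFun_apply_toFun, TubeDiffeo.symm_apply_apply]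
  · rw [ν.twistFun_of_not_mem G h, ν.twistFun_of_not_mem G.symm h]

/-- `twistFun` for `G` undoes `twistFun` for `G.symm`. [folklore] -/
theorem twistFun_twistFun_symm (x : X) : ν.twistFun G (ν.twistFun G.symm x) = x := by
  simpa using ν.twistFun_symm_twistFun G.symm x

/-- The surgery relation only uses the unit ball bundle of the tube: tubes of the same circle that
agree on `𝕊¹ × B(0, 1)` have the same surgery relation. [folklore] -/
theorem circleSurgeryRel_congr_of_eqOn {ν₁ ν₂ : CircleNbhd (𝓡 4) c}
    (h : ∀ (u : 𝕊 1) (w : 𝔼 3), ‖w‖ < 1 → ν₁.toFun (u, w) = ν₂.toFun (u, w))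
    (a : ↥(range c)ᶜ) (b : ↥discTimesSphere) :
    circleSurgeryRel ν₁ a b ↔ circleSurgeryRel ν₂ a b := by
  refine exists_congr fun u ↦ exists_congr fun t ↦ and_congr_right fun ht ↦
    and_congr_right fun _ ↦ ?_
  rw [h u _ ?_]
  rw [norm_smul, Real.norm_of_nonneg ht.1.le, norm_eq_of_mem_sphere (b : (𝔼 2) × (𝕊 2)).2, mul_one]
  exact ht.2

variable [T2Space X]

/-- **`twistFun` is smooth.** On the open range of `ν` it is `ν ∘ G ∘ ν⁻¹`; off the compact set
`ν(𝕊¹ × B̄(0, radius))` it is the identity; the two open sets cover `X`. [folklore] -/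
theorem contMDiff_twistFun : ContMDiff (𝓡 4) (𝓡 4) ∞ (ν.twistFun G) := by
  intro x
  by_cases hx : x ∈ range ν.toFun
  · -- near a point of the tube: `ν ∘ G ∘ ν⁻¹`
    have hnhds : range ν.toFun ∈ 𝓝 x := ν.isOpen_range.mem_nhds hx
    have heq : ν.twistFun G =ᶠ[𝓝 x] fun y ↦ ν.toFun (G.toDiffeomorph (ν.toHomeo.symm y)) := by
      filter_upwards [hnhds] with y hy
      rw [twistFun, if_pos hy]
    refine ContMDiffAt.congr_of_eventuallyEq ?_ heq
    have h1 : ContMDiffAt (𝓡 4) ((𝓡 1).prod 𝓘(ℝ, 𝔼 3)) ∞ ν.toHomeo.symm x :=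
      (ν.contMDiffOn_toHomeo_symm x hx).contMDiffAt hnhds
    exact (ν.contMDiff.comp G.toDiffeomorph.contMDiff).contMDiffAt.comp x h1
  · -- off the tube: the identity near `x`
    set K : Set X := ν.toFun '' (univ ×ˢ Metric.closedBall (0 : 𝔼 3) G.radius) with hK
    have hKc : IsCompact K :=
      (isCompact_univ.prod (isCompact_closedBall _ _)).image ν.continuous
    have hxK : x ∉ K := by
      rintro ⟨p, -, rfl⟩
      exact hx (mem_range_self p)
    have hnhds : Kᶜ ∈ 𝓝 x := hKc.isClosed.isOpen_compl.mem_nhds hxK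
    have heq : ν.twistFun G =ᶠ[𝓝 x] id := by
      filter_upwards [hnhds] with y hy
      apply ν.twistFun_eq_self G
      rintro ⟨p, hp, rfl⟩
      exact hy ⟨p, ⟨mem_univ _, Metric.mem_closedBall.2 (by simpa using hp.le)⟩, rfl⟩
    exact contMDiffAt_id.congr_of_eventuallyEq heq

/-- **The ambient diffeomorphism of a tube reparametrisation**: `ν ∘ G ∘ ν⁻¹` on the tube, the
identity elsewhere, with inverse the same construction for `G⁻¹`. [cite: GompfStipsiczGSM1999, §5.2] -/
def twistDiffeo : X ≃ₘ⟮𝓡 4, 𝓡 4⟯ X where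
  toFun := ν.twistFun G
  invFun := ν.twistFun G.symm
  left_inv := ν.twistFun_symm_twistFun G
  right_inv := ν.twistFun_twistFun_symm G
  contMDiff_toFun := ν.contMDiff_twistFun G
  contMDiff_invFun := ν.contMDiff_twistFun G.symm

/-- `twistDiffeo ν G ∘ ν = ν ∘ G`. [folklore] -/
@[simp] theorem twistDiffeo_apply_toFun (p : (𝕊 1) × 𝔼 3) :
    ν.twistDiffeo G (ν.toFun p) = ν.toFun (G.toDiffeomorph p) :=
  ν.twistFun_apply_toFun G p

/-- The inverse: `(twistDiffeo ν G)⁻¹ ∘ ν = ν ∘ G⁻¹`. [folklore] -/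
@[simp] theorem twistDiffeo_symm_apply_toFun (p : (𝕊 1) × 𝔼 3) :
    (ν.twistDiffeo G).symm (ν.toFun p) = ν.toFun (G.symm.toDiffeomorph p) :=
  ν.twistFun_apply_toFun G.symm p

/-- The ambient diffeomorphism fixes the core circle pointwise. [folklore] -/
theorem twistDiffeo_apply_curve (u : 𝕊 1) : ν.twistDiffeo G (c u) = c u := by
  rw [← ν.apply_zero u, twistDiffeo_apply_toFun, G.apply_zero]

/-- The inverse fixes the core circle pointwise. [folklore] -/
theorem twistDiffeo_symm_apply_curve (u : 𝕊 1) : (ν.twistDiffeo G).symm (c u) = c u := by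
  rw [← ν.apply_zero u, twistDiffeo_symm_apply_toFun, G.symm.apply_zero]

variable [IsManifold (𝓡 4) ∞ X]

/-- The ambient diffeomorphism restricted to the complement of the core circle. [folklore] -/
def twistComplement : ↥ν.complement ≃ₘ⟮𝓡 4, 𝓡 4⟯ ↥ν.complement where
  toFun a := ⟨ν.twistDiffeo G a, by
    rintro ⟨u, hu⟩
    refine a.2 ⟨u, ?_⟩
    rw [← ν.twistDiffeo_apply_curve G u] at hu
    exact (ν.twistDiffeo G).injective hu⟩
  invFun a := ⟨(ν.twistDiffeo G).symm a, by
    rintro ⟨u, hu⟩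
    refine a.2 ⟨u, ?_⟩
    rw [← ν.twistDiffeo_symm_apply_curve G u] at hu
    exact (ν.twistDiffeo G).symm.injective hu⟩
  left_inv a := Subtype.ext ((ν.twistDiffeo G).symm_apply_apply a)
  right_inv a := Subtype.ext ((ν.twistDiffeo G).apply_symm_apply a)
  contMDiff_toFun := by
    refine (ContMDiff.subtypeVal_comp_iff _ _).1 ?_
    exact (ν.twistDiffeo G).contMDiff.comp contMDiff_subtype_val
  contMDiff_invFun := by
    refine (ContMDiff.subtypeVal_comp_iff _ _).1 ?_
    exact (ν.twistDiffeo G).symm.contMDiff.comp contMDiff_subtype_val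

omit [IsManifold (𝓡 4) ∞ X] in
/-- The restricted inverse, pointwise. [folklore] -/
@[simp] theorem coe_twistComplement_symm_apply (a : ↥ν.complement) :
    ((ν.twistComplement G).symm a : X) = (ν.twistDiffeo G).symm a := rfl

/-! ### Invariance of the surgery -/

/-- **Transport of the surgery gluing along the tube reparametrisation.** If `P` is an open
gluing of `X ∖ c` and `D̊² × 𝕊²` along `circleSurgeryRel ν`, then — precomposing the embedding of
`X ∖ c` with the restriction of `(twistDiffeo ν G)⁻¹` — it is also an open gluing along
`circleSurgeryRel (ν.twist G)` (Kosinski VI.1: transport of a gluing along a diffeomorphism of a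
piece). [cite: Kosinski1993, Ch. VI §1 (transport of gluings)] -/
theorem isOpenGluing_twist_of_isOpenGluing {P : Type*} [TopologicalSpace P] [ChartedSpace (𝔼 4) P]
    (h : IsOpenGluing (𝓡 4) (𝓘(ℝ, 𝔼 2).prod (𝓡 2)) (𝓡 4) (A := ↥ν.complement) (B := ↥discTimesSphere)
      (P := P) (circleSurgeryRel ν)) :
    IsOpenGluing (𝓡 4) (𝓘(ℝ, 𝔼 2).prod (𝓡 2)) (𝓡 4) (A := ↥(ν.twist G).complement)
      (B := ↥discTimesSphere) (P := P) (circleSurgeryRel (ν.twist G)) := by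
  obtain ⟨jA, jB, hA, hAo, hB, hBo, hU, hR⟩ := h
  have hsurj : Surjective (fun a ↦ (ν.twistComplement G).symm a) :=
    fun a ↦ ⟨ν.twistComplement G a, (ν.twistComplement G).symm_apply_apply a⟩
  refine ⟨jA ∘ (ν.twistComplement G).symm, jB, hA.comp_diffeomorph (ν.twistComplement G).symm, ?_,
    hB, hBo, ?_, fun a b ↦ ?_⟩
  · show IsOpen (range (jA ∘ fun a ↦ (ν.twistComplement G).symm a))
    rwa [hsurj.range_comp]
  · show range (jA ∘ fun a ↦ (ν.twistComplement G).symm a) ∪ range jB = univ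
    rwa [hsurj.range_comp]
  · rw [Function.comp_apply, hR]
    simp only [circleSurgeryRel, coe_twistComplement_symm_apply, twist_apply]
    refine exists_congr fun u ↦ exists_congr fun t ↦ and_congr_right fun _ ↦
      and_congr_right fun _ ↦ ?_
    constructor
    · intro h1
      rw [← twistDiffeo_apply_toFun, ← h1, Diffeomorph.apply_symm_apply]
    · intro h1
      rw [h1, ← twistDiffeo_apply_toFun, Diffeomorph.symm_apply_apply]


/-- **`ν.Surgered` is a surgery along the reparametrised tube `ν ∘ G`.** [cite: GompfStipsiczGSM1999, §5.2] -/
theorem isOpenGluing_surgered_twist :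
    IsOpenGluing (𝓡 4) (𝓘(ℝ, 𝔼 2).prod (𝓡 2)) (𝓡 4) (A := ↥(ν.twist G).complement)
      (B := ↥discTimesSphere) (P := ν.Surgered) (circleSurgeryRel (ν.twist G)) :=
  ν.isOpenGluing_twist_of_isOpenGluing G ν.isOpenGluing_surgered

/-- **Reparametrising the tube by a compactly supported diffeomorphism does not change the
surgery**: `ν.Surgered ≅ (ν ∘ G).Surgered` (uniqueness of open gluings). [cite: GompfStipsiczGSM1999, §5.2] -/
theorem nonempty_diffeomorph_surgered_twist :
    Nonempty (ν.Surgered ≃ₘ⟮𝓡 4, 𝓡 4⟯ (ν.twist G).Surgered) :=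
  IsOpenGluing.nonempty_diffeomorph (ν.isOpenGluing_surgered_twist G) (ν.twist G).isOpenGluing_surgered

/-- **A tube that agrees with `ν ∘ G` on the unit ball bundle gives the same surgery**:
`ν.Surgered ≅ ν'.Surgered`. This is the form used for the framings of the section circle of the
Cappell–Shaneson mapping torus, where `ν' = ν ∘ (u, w) ↦ (u, G_u w)` only on `𝕊¹ × B(0, 1)`. [cite: GompfStipsiczGSM1999, §5.2] -/
theorem nonempty_diffeomorph_surgered_of_eqOn_twist (ν' : CircleNbhd (𝓡 4) c)
    (h : ∀ (u : 𝕊 1) (w : 𝔼 3), ‖w‖ < 1 → ν'.toFun (u, w) = ν.toFun (G.toDiffeomorph (u, w))) :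
    Nonempty (ν.Surgered ≃ₘ⟮𝓡 4, 𝓡 4⟯ ν'.Surgered) := by
  have h₁ := ν.isOpenGluing_surgered_twist G
  have h₂ : IsOpenGluing (𝓡 4) (𝓘(ℝ, 𝔼 2).prod (𝓡 2)) (𝓡 4) (A := ↥ν'.complement)
      (B := ↥discTimesSphere) (P := ν.Surgered) (circleSurgeryRel ν') := by
    obtain ⟨jA, jB, hA, hAo, hB, hBo, hU, hR⟩ := h₁
    refine ⟨jA, jB, hA, hAo, hB, hBo, hU, fun a b ↦ (hR a b).trans ?_⟩
    exact circleSurgeryRel_congr_of_eqOn (fun u w hw ↦ (h u w hw).symm) a b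
  exact IsOpenGluing.nonempty_diffeomorph h₂ ν'.isOpenGluing_surgered

end CircleNbhd

end Literature.Topology.FourManifolds
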